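import Literature.MathematicalPhysics.QuantumFieldTheory.Balaban1983to89.T4SegmentCurvature

/-!
# T4MeanLipschitzBirth — `MeanLipschitz` / `CondMeanSuppression` AT BIRTH SCALE: the disc-inclusion hypothesis of
`T4AxialChain.meanLipschitz_of_segment` discharged into a typed plaquette-level tube
(cell `pub-balaban`, self-proposed kernel row T4-O3.E-i′-β-ASSEMBLE*, the (β)-node assembly announced in
`t4/T4-EST-O3Ei1.md` v1.2.1 §4b and `t4/T4-XREAD-O3Ob3.md` v1.4 §6.4/§7.3; bookkeeping only)

HONEST FRAMING (cell `pub-balaban`, T4-DAG PAGE 1).  The cell's T4 target is the existence AND uniqueness of the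
continuum limit of Bałaban's unit-scale averaged loop expectations on a finite torus — a constructive-QFT statement
strictly beyond ultraviolet stability ([Balaban1989LargeFieldII] Thm 1 p. 355); it is NOT the Yang–Mills mass gap and
NOT the Clay problem.  This module is ELEMENTARY BOOKKEEPING assembling three siblings:
`T4FirstOrderSize.MeanLipschitz` (the hypothesis shape "‖m u b − m u₀ b‖ ≤ lip · dev u"),
`T4AxialChain.meanLipschitz_of_segment` (Cauchy along the real interpolation segment: it ASKS, per exterior
configuration `u` and bond `b`, for an analytic slice `g` bounded by `B` on SOME set `D ⊆ ℂ` containing the closed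
discs of radius `α₁′/dev u` about `[0, 1]`) and `T4SegmentCurvature.norm_hol_sub_one_le_of_condition'` ((F2′): along
those discs the plaquette variables of the pure-potential segment configuration `i ↦ exp(iξ·s·A_u(i))` deviate from
`1` by at most `α₀ξ²`, given the exterior's own curvature constant `δ₀ ≤ κ·dev u`, potentials `≤ dev u` and the budget
`δ₀ + κα₁′ + 32(dev u + α₁′)² ≤ α₀ ≤ 1/2`).  What is typed here:
* §1 [arith] THE BIRTH BUDGET.  At the birth scale `k = j` the exterior may carry the class's own curvature constant
  (`δ₀ ≤ a`, `a` standing for `α_{0,j}`), so `T4SegmentCurvature.curvature_budget` (`δ₀ ≤ α₀/4`) is not the right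
  packaging; instead the TARGET constant is the enlarged one, `α₀ := (1 + μ)·a`, and the budget reads
  `δ₀ ≤ a ∧ κα₁′ + 32(dev + α₁′)² ≤ μ·a ⇒ δ₀ + κα₁′ + 32(dev + α₁′)² ≤ (1 + μ)·a` (`curvature_budget_birth`), with
  the quadratic member monotone in `dev` (`quadratic_member_mono`), met for small coupling when it is `O(g²)` against
  `a ≥ C₀·g` (`quadratic_member_le_of_small_coupling`), and `(1 + μ)·a ≤ 1/2` for `μ ≤ 1/4`, `a ≤ 2/5`
  (`target_le_half`).  The cell's record books `μ = β/2 = 1/8` of the printed creation enlargement `1 + β`, `β = 1/4`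
  ([Balaban1988Convergent] (3.43) p. 276, quoted below) — a CELL CHOICE, not a printed number.
* §2 [bookkeeping] THE TUBE.  `plaqHol c A p` = the plaquette variable `exp(cA₁)exp(cA₂)exp(−cA₃)exp(−cA₄)` of the
  pure-potential configuration around the oriented plaquette `p = (i₁, i₂, i₃, i₄)` (the sibling's written-out
  product, now named); `segScalar ξ s = iξs`; `tubeParam ξ α₀ α₁′ t plaq A N` = the set of complex segment
  parameters `s` at which the cell's PLAQUETTE-LEVEL MODEL of the four small-field clauses holds for the segment
  configuration `exp(iξsA) = exp(iξ·i(Im s)A)·exp(iξ(Re s)A)`: (C1) `|Im s|·N ≤ α₁′` (size of the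
  imaginary-direction potential `A′_s = i(Im s)A`, cf. (1.13)), (C2) `|Re s|·N ≤ t` (size of the real potential
  `(Re s)A`, cf. (1.12)), (C3) `‖plaqHol (iξs) A p − 1‖ ≤ α₀ξ²` on `plaq` (complex curvature, cf. (1.14)),
  (C4) the same at the real scalar `iξ·Re s` (curvature of the G-valued factor, cf. (1.11)); `N` is any gauge of the
  potential with `‖A i‖ ≤ N` (intended: the sup of `|A|` AND of its difference quotients, so that the `∇`-halves of
  (1.12)/(1.13) ride on (C1)/(C2)).  THE DISC INCLUSION (`closedBall_subset_tubeParam`): for `0 < dev`,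
  `N ≤ dev`, endpoint curvature `≤ δξ²` on `plaq`, `δ ≤ κ·dev`, `δ + κα₁′ + 32(dev + α₁′)² ≤ α₀ ≤ 1/2`,
  `dev + α₁′ ≤ t`, every closed disc of radius `α₁′/dev` about a point of `[0, 1]` lies in the tube — (C1) from
  `|Im s| ≤ α₁′/dev`, (C2) from `|Re s| ≤ |s| ≤ 1 + α₁′/dev` (`T4SegmentCurvature.norm_le_one_add_of_mem_closedBall`),
  (C3)/(C4) from (F2′) at the excursions `σ = |s|` and `σ = |Re s|`.
* §3 [bookkeeping] THE ASSEMBLY.  `meanLipschitz_birth`: chain data per `u ∈ dom` (`0 ≤ N u ≤ dev u`,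
  `‖A u i‖ ≤ N u`, endpoint curvature `δ u ≤ κ·dev u`), the budget, and — the ONLY analytic input, a HYPOTHESIS —
  an analytic slice bounded by `B` ON THE TUBE with endpoints `m u₀ b`, `m u b` give
  `MeanLipschitz dom m S u₀ dev (4B/α₁′)`; `condMeanSuppression_birth` adds `MeanVanishes` at the flat reference
  (`T4FirstOrderSize.condMeanSuppression_of_flat`); `…_uniform`: the same from uniform constants `δ u ≤ a`,
  `dev u ≤ dev₀` and the §1 budget at `α₀ = (1 + μ)a`, `t = dev₀ + α₁′`.
* §4 [bookkeeping] THE CONFIGURATION-LEVEL LEAF (finite bond set).  `segConfig ξ A s = (i ↦ exp(iξs·A i))` is an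
  entire function of `s` (`differentiable_segConfig`, Mathlib `hasDerivAt_exp_smul_const`), equal to `1` at `s = 0`;
  if a functional `Mc` (intended: the analytically continued conditional mean as a function of the complex link
  configuration of the region, axial gauge fixed) is complex differentiable and bounded by `B` on a set `𝒞` of
  configurations CONTAINING every `segConfig ξ (A u) s` with `s` in the tube, and `m u b = Mc (segConfig ξ (A u) 1) b`,
  `m u₀ b = Mc 1 b` — SET-UP (b1) of `t4/T4-XREAD-O3Ob3.md` §7.3: `dom` ⊆ axial-gauge representatives, so `u` IS
  `exp(iξA_u)` and no gauge covariance is used — then the slice hypotheses of §3 hold and the flat case `dev u = 0`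
  needs no separate hypothesis (`meanLipschitz_birth_of_class`, `condMeanSuppression_birth_of_class`).
NOT DISCHARGED here, stated so that nobody reads more into the module: (a) the TOWER condition (iv) of
[Balaban1987RG1] p. 262 ((1.15)/(1.16)) along the segment — format obligation O-β3-a′, located by the cell as a
consequence of (i)–(iii) at primed constants ([Balaban1987RG1] p. 263 (1.17), smallness line S-B12.5), NOT modelled
by the tube; (b) the `|𝐉| < γ₀` half of (1.14) and the local-gauge EXISTENCE clause of (1.12) beyond the size clause
(C2); (c) the G^c-gauge covariance of the conditional mean (O-β3-b) — replaced by the set-up (b1), i.e. by the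
hypotheses `hm`, `hm₀` of §4; (d) the identification of `tubeParam`/`𝒞` with (a subset of) any printed space
`𝐔^c_j(X, α₀, α₁)`, of `Mc`/`m` with Bałaban's conditional means, of `N u, dev u, δ u` with norms of an actual
axial-gauge potential, and the values `a = α_{0,j}`, `μ = 1/8` — all remain the instantiating seat's readings and
HYPOTHESES.  Value = kernel bookkeeping closing the (β) node's assembly step; NOT summit progress; NO statement about
Bałaban's renormalization-group objects is asserted.

MOTIVATING PRINTED LOCI (verbatim, journal page numbers; CONTEXT ONLY — nothing below is a formalisation of them).
* [Balaban1987RG1] (CMP 109) p. 262, the four clauses modelled by (C1)–(C4): "(i) 𝐔 = U′U, U has values in the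
  group G, |∂U − 1| < α₀ξ² on X, (1.11) for each cube □ ⊂ X of a size O(1)LM there exists a G-valued gauge
  transformation u defined on □ and such, that U^u = exp iξA, |A|, |∇^ξA| < O(1)LMBα₀ on □, (1.12) with a
  sufficiently large constant B (it will be determined later). (ii) U′ = exp iξA′, A′ has values in the algebra 𝐠^c,
  |A′|, |∇^ξ_U A′| < α₁ on X. (1.13) (iii) The configurations 𝐔, 𝐉 satisfy the bounds |∂𝐔 − 1| < α₀ξ², |𝐉| < γ₀
  on X. (1.14)".  [cite: Balaban1987RG1, (1.11)–(1.14) p. 262]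
* [Balaban1988Convergent] (CMP 119) p. 259, which space and which constants name the analyticity domain of the
  scale-`j` terms: "(ii) there exists an analytic function 𝐄^{(j)}(X, (𝐔, 𝐉), z) of the variables
  (𝐔, 𝐉) ∈ U^c_j(X, α_{0,j}, α_{1,j}), which is an extension of this term, i.e., the equality (I.1.9) is satisfied;
  (iii) the extended function is invariant with respect to the gauge transformations (I.1.10); (iv) it satisfies the
  inequality (I.1.18). These properties are the same as in [I.1]. The numbers α_{0,j}, α_{1,j} in the symbol of the
  space are given by α_{0,j} = g_jC₀(log g_j^{−2})^{q₀}, α_{1,j} = g_jC₁(log g_j^{−2})^{q₁}, (2.28) where q₀, q₁ are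
  integers greater than 1, C₀, C₁ are sufficiently large positive numbers."
  [cite: Balaban1988Convergent, (2.28) p. 259]
* [Balaban1988Convergent] (CMP 119) p. 276, the creation enlargement whose fraction `μ` §1 books: "The remaining
  terms satisfy such conditions also, but with analyticity space (I.6.34) replaced by the space
  Ũ^c_{k+1}(Y, (1 + β)α̃₀, (1 + β)α̃₁) × {A : supp A ⊂ Y∩Λ^{(k)*}_{k+1}, |A| < C₁p₁(g_k)} . (3.43) Notice also that
  the localization domains occurring in this expansion have nonempty intersections with Λ_{k+1}. These remaining
  terms will contribute to the boundary terms 𝐁^{(k+1)} in the final expansion."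
  [cite: Balaban1988Convergent, (3.43) p. 276]
Renders read (as images, this seat, for the three quotations above): CMP 109 p. 262 (PDF p. 14, ×2), CMP 119 p. 259
(PDF p. 17, ×2), CMP 119 p. 276 (PDF p. 34, ×2).
-/

noncomputable section

namespace Literature.MathematicalPhysics.QuantumFieldTheory.Balaban1983to89.T4MeanLipschitzBirth

open NormedSpace Set Metric

/-! ## §1  The birth budget [arith] -/

section Budget

/-- THE BIRTH BUDGET: if the exterior's curvature constant is at most the class constant `a` and the members the
cell controls (`κα₁′` and the quadratic potential member) fit into the booked fraction `μ·a` of the creation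
enlargement, then the (F2′) condition holds with the TARGET constant `(1 + μ)·a`. [folklore] -/
theorem curvature_budget_birth {a μ α₁' dev δ₀ κ : ℝ} (hδ : δ₀ ≤ a)
    (hq : κ * α₁' + 32 * (dev + α₁') ^ 2 ≤ μ * a) :
    δ₀ + κ * α₁' + 32 * (dev + α₁') ^ 2 ≤ (1 + μ) * a := by
  linarith

/-- The controlled members are monotone in the potential deviation: a budget checked at a uniform bound `dev₀`
serves every `dev ≤ dev₀`. [folklore] -/
theorem quadratic_member_mono {κ α₁' dev dev₀ : ℝ} (hα₁ : 0 ≤ α₁') (hdev0 : 0 ≤ dev) (hdev : dev ≤ dev₀) :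
    κ * α₁' + 32 * (dev + α₁') ^ 2 ≤ κ * α₁' + 32 * (dev₀ + α₁') ^ 2 := by
  have h : (dev + α₁') ^ 2 ≤ (dev₀ + α₁') ^ 2 := pow_le_pow_left₀ (by positivity) (by linarith) 2
  linarith

/-- SMALL COUPLING: a member `Q ≤ C_q·g²` fits into `μ·a` as soon as `a ≥ C₀·g` and `g ≤ μ·C₀/C_q` — the
cell's reading of "O(g²·polylog) against α_{0,j} = O(g·polylog)", constants only. [folklore] -/
theorem quadratic_member_le_of_small_coupling {Q Cq C₀ g μ a : ℝ} (hCq : 0 < Cq) (hg0 : 0 ≤ g) (hμ : 0 ≤ μ)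
    (hQ : Q ≤ Cq * g ^ 2) (ha : C₀ * g ≤ a) (hg : g ≤ μ * C₀ / Cq) : Q ≤ μ * a := by
  have h1 : Cq * g ≤ μ * C₀ := by
    have h := (le_div_iff₀ hCq).mp hg
    linarith [mul_comm g Cq]
  have h2 : Cq * g ^ 2 ≤ μ * C₀ * g := by
    have h := mul_le_mul_of_nonneg_right h1 hg0
    nlinarith
  have h3 : μ * C₀ * g ≤ μ * a := by
    have h := mul_le_mul_of_nonneg_left ha hμ
    linarith [mul_assoc μ C₀ g]
  linarith

/-- The target constant stays in the quadratic regime of (F2′): `(1 + μ)·a ≤ 1/2` for `μ ≤ 1/4`, `a ≤ 2/5`.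
[folklore] -/
theorem target_le_half {a μ : ℝ} (ha0 : 0 ≤ a) (hμ : μ ≤ 1 / 4) (ha : a ≤ 2 / 5) :
    (1 + μ) * a ≤ 1 / 2 := by
  nlinarith

end Budget

/-! ## §2  The plaquette-level tube and the disc inclusion [bookkeeping] -/

section Tube

variable {ι : Type*} {𝔸 : Type*} [NormedRing 𝔸] [NormedAlgebra ℂ 𝔸] [CompleteSpace 𝔸]

/-- The PLAQUETTE VARIABLE of the pure-potential configuration `i ↦ exp (c • A i)` around the oriented plaquette
`p = (i₁, i₂, i₃, i₄)` (the last two bonds traversed backwards): `exp(cA₁)·exp(cA₂)·exp(−cA₃)·exp(−cA₄)` — the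
written-out product of `T4SegmentCurvature` §2, named. [folklore] -/
def plaqHol (c : ℂ) (A : ι → 𝔸) (p : ι × ι × ι × ι) : 𝔸 :=
  exp (c • A p.1) * exp (c • A p.2.1) * exp (-(c • A p.2.2.1)) * exp (-(c • A p.2.2.2))

/-- The scalar of the complexified segment at parameter `s`: `iξs`. [folklore] -/
def segScalar (ξ : ℝ) (s : ℂ) : ℂ := Complex.I * ξ * s

/-- The flat endpoint of the segment has scalar `0`. [folklore] -/
@[simp] theorem segScalar_zero (ξ : ℝ) : segScalar ξ 0 = 0 := by simp [segScalar]

/-- `‖iξs‖ = ξ|s|` for `ξ ≥ 0`. [folklore] -/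
theorem norm_segScalar {ξ : ℝ} (hξ : 0 ≤ ξ) (s : ℂ) : ‖segScalar ξ s‖ = ξ * ‖s‖ := by
  unfold segScalar
  rw [norm_mul, norm_mul, Complex.norm_I, one_mul, Complex.norm_real, Real.norm_of_nonneg hξ]

/-- THE TUBE (the cell's plaquette-level MODEL of the small-field clauses for the segment configuration
`exp(iξsA)`; NOT a printed space): the complex parameters `s` with (C1) `|Im s|·N ≤ α₁′`, (C2) `|Re s|·N ≤ t`,
(C3) complex curvature `‖plaqHol (iξs) A p − 1‖ ≤ α₀ξ²` on `plaq`, (C4) the same at the real scalar `iξ·Re s`.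
The printed clauses are the LOCUS MODELLED; nothing printed is asserted. [cite: Balaban1987RG1, (1.11)–(1.14) p. 262] -/
def tubeParam (ξ α₀ α₁' t : ℝ) (plaq : Set (ι × ι × ι × ι)) (A : ι → 𝔸) (N : ℝ) : Set ℂ :=
  {s | |s.im| * N ≤ α₁' ∧ |s.re| * N ≤ t ∧
    (∀ p ∈ plaq, ‖plaqHol (segScalar ξ s) A p - 1‖ ≤ α₀ * ξ ^ 2) ∧
    ∀ p ∈ plaq, ‖plaqHol (segScalar ξ (s.re : ℂ)) A p - 1‖ ≤ α₀ * ξ ^ 2}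

omit [CompleteSpace 𝔸] in
/-- Membership in the tube, unfolded (the four clauses (C1)–(C4)). [folklore] -/
theorem mem_tubeParam {ξ α₀ α₁' t : ℝ} {plaq : Set (ι × ι × ι × ι)} {A : ι → 𝔸} {N : ℝ} {s : ℂ} :
    s ∈ tubeParam ξ α₀ α₁' t plaq A N ↔ |s.im| * N ≤ α₁' ∧ |s.re| * N ≤ t ∧
      (∀ p ∈ plaq, ‖plaqHol (segScalar ξ s) A p - 1‖ ≤ α₀ * ξ ^ 2) ∧
      ∀ p ∈ plaq, ‖plaqHol (segScalar ξ (s.re : ℂ)) A p - 1‖ ≤ α₀ * ξ ^ 2 :=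
  Iff.rfl

/-- THE DISC INCLUSION (the hypothesis `hseg`'s last clause in `T4AxialChain.meanLipschitz_of_segment`,
DISCHARGED into the tube): with potentials `‖A i‖ ≤ N ≤ dev`, `0 < dev`, endpoint (real exterior, `s = 1`)
curvature `≤ δξ²` on `plaq`, `δ ≤ κ·dev`, the (F2′) budget `δ + κα₁′ + 32(dev + α₁′)² ≤ α₀ ≤ 1/2`, `0 < ξ ≤ 1`
and `dev + α₁′ ≤ t`, every closed disc of radius `α₁′/dev` about a point of `[0, 1]` lies in the tube.
[folklore] -/
theorem closedBall_subset_tubeParam {ξ α₀ α₁' t dev N δ κ : ℝ} {plaq : Set (ι × ι × ι × ι)} {A : ι → 𝔸}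
    (hξ0 : 0 < ξ) (hξ1 : ξ ≤ 1) (hα₀ : α₀ ≤ 1 / 2) (hα₁ : 0 ≤ α₁') (hκ : 0 ≤ κ) (hdev : 0 < dev)
    (hN0 : 0 ≤ N) (hN : N ≤ dev) (hA : ∀ i, ‖A i‖ ≤ N) (hδ0 : 0 ≤ δ) (hδ : δ ≤ κ * dev)
    (hsum : δ + κ * α₁' + 32 * (dev + α₁') ^ 2 ≤ α₀) (ht : dev + α₁' ≤ t)
    (hcurv : ∀ p ∈ plaq, ‖plaqHol (segScalar ξ 1) A p - 1‖ ≤ δ * ξ ^ 2)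
    {s₀ : ℝ} (hs₀ : s₀ ∈ Icc (0 : ℝ) 1) :
    closedBall (s₀ : ℂ) (α₁' / dev) ⊆ tubeParam ξ α₀ α₁' t plaq A N := by
  intro s hs
  have hϱ : ‖s‖ ≤ 1 + α₁' / dev := T4SegmentCurvature.norm_le_one_add_of_mem_closedBall hs₀ hs
  have hdist : ‖s - (s₀ : ℂ)‖ ≤ α₁' / dev := by rwa [mem_closedBall, dist_eq_norm] at hs
  have him : |s.im| ≤ α₁' / dev := by
    have h1 : |(s - (s₀ : ℂ)).im| ≤ ‖s - (s₀ : ℂ)‖ := Complex.abs_im_le_norm _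
    have h2 : (s - (s₀ : ℂ)).im = s.im := by simp
    rw [h2] at h1
    exact h1.trans hdist
  have hre : |s.re| ≤ 1 + α₁' / dev := (Complex.abs_re_le_norm s).trans hϱ
  have hc₁ : ‖segScalar ξ 1‖ = ξ := by rw [norm_segScalar hξ0.le, norm_one, mul_one]
  have hϱ0 : 0 ≤ α₁' / dev := div_nonneg hα₁ hdev.le
  refine ⟨?_, ?_, ?_, ?_⟩
  · calc |s.im| * N ≤ α₁' / dev * N := mul_le_mul_of_nonneg_right him hN0
      _ ≤ α₁' / dev * dev := mul_le_mul_of_nonneg_left hN hϱ0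
      _ = α₁' := div_mul_cancel₀ α₁' hdev.ne'
  · calc |s.re| * N ≤ (1 + α₁' / dev) * N := mul_le_mul_of_nonneg_right hre hN0
      _ ≤ (1 + α₁' / dev) * dev := mul_le_mul_of_nonneg_left hN (by linarith)
      _ = dev + α₁' := by rw [add_mul, one_mul, div_mul_cancel₀ α₁' hdev.ne']
      _ ≤ t := ht
  · intro p hp
    exact T4SegmentCurvature.norm_hol_sub_one_le_of_condition' (c₁ := segScalar ξ 1) (segScalar ξ s)
      (A p.1) (A p.2.1) (A p.2.2.1) (A p.2.2.2) hξ0 hξ1 hα₀ hdev hα₁ hκ hδ0 hδ hsum (norm_nonneg s) hϱ hc₁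
      (norm_segScalar hξ0.le s) hN0 hN (hA _) (hA _) (hA _) (hA _) (hcurv p hp)
  · intro p hp
    have hσ : ‖((s.re : ℝ) : ℂ)‖ ≤ 1 + α₁' / dev := by
      rw [Complex.norm_real, Real.norm_eq_abs]; exact hre
    exact T4SegmentCurvature.norm_hol_sub_one_le_of_condition' (c₁ := segScalar ξ 1)
      (segScalar ξ (s.re : ℂ)) (A p.1) (A p.2.1) (A p.2.2.1) (A p.2.2.2) hξ0 hξ1 hα₀ hdev hα₁ hκ hδ0 hδ
      hsum (norm_nonneg _) hσ hc₁ (norm_segScalar hξ0.le _) hN0 hN (hA _) (hA _) (hA _) (hA _) (hcurv p hp)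

/-- In particular the real segment itself lies in the tube (the centres of the discs). [folklore] -/
theorem ofReal_mem_tubeParam {ξ α₀ α₁' t dev N δ κ : ℝ} {plaq : Set (ι × ι × ι × ι)} {A : ι → 𝔸}
    (hξ0 : 0 < ξ) (hξ1 : ξ ≤ 1) (hα₀ : α₀ ≤ 1 / 2) (hα₁ : 0 ≤ α₁') (hκ : 0 ≤ κ) (hdev : 0 < dev)
    (hN0 : 0 ≤ N) (hN : N ≤ dev) (hA : ∀ i, ‖A i‖ ≤ N) (hδ0 : 0 ≤ δ) (hδ : δ ≤ κ * dev)
    (hsum : δ + κ * α₁' + 32 * (dev + α₁') ^ 2 ≤ α₀) (ht : dev + α₁' ≤ t)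
    (hcurv : ∀ p ∈ plaq, ‖plaqHol (segScalar ξ 1) A p - 1‖ ≤ δ * ξ ^ 2)
    {s₀ : ℝ} (hs₀ : s₀ ∈ Icc (0 : ℝ) 1) : (s₀ : ℂ) ∈ tubeParam ξ α₀ α₁' t plaq A N :=
  closedBall_subset_tubeParam hξ0 hξ1 hα₀ hα₁ hκ hdev hN0 hN hA hδ0 hδ hsum ht hcurv hs₀
    (mem_closedBall_self (div_nonneg hα₁ hdev.le))

end Tube

/-! ## §3  The assembly: `MeanLipschitz` and `CondMeanSuppression` at birth from an analytic slice ON THE TUBE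
[bookkeeping] -/

section Assembly

variable {ι : Type*} {𝔸 : Type*} [NormedRing 𝔸] [NormedAlgebra ℂ 𝔸] [CompleteSpace 𝔸]
variable {𝒰 β F : Type*} [NormedAddCommGroup F] [NormedSpace ℂ F] [CompleteSpace F]

/-- THE (β)-NODE HAND-OFF AT BIRTH.  Data per exterior configuration `u ∈ dom`: an axial potential `A u` with a
gauge `0 ≤ N u ≤ dev u`, `‖A u i‖ ≤ N u`; its real-endpoint curvature constant `0 ≤ δ u ≤ κ·dev u` on the plaquettes
`plaq`; the (F2′) budget `δ u + κα₁′ + 32(dev u + α₁′)² ≤ α₀ ≤ 1/2` and `dev u + α₁′ ≤ t`; and — the one ANALYTIC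
INPUT, a HYPOTHESIS — for `dev u > 0` and `b ∈ S` an analytic slice bounded by `B` ON THE TUBE
`tubeParam ξ α₀ α₁′ t plaq (A u) (N u)` with endpoints `m u₀ b` (`s = 0`) and `m u b` (`s = 1`), flat means when
`dev u = 0`.  Then `MeanLipschitz dom m S u₀ dev (4B/α₁′)` — `T4AxialChain.meanLipschitz_of_segment` with its disc
inclusion supplied by `closedBall_subset_tubeParam`.  Nothing printed is asserted. [folklore] -/
theorem meanLipschitz_birth {dom : Set 𝒰} {m : 𝒰 → β → F} {S : Finset β} {u₀ : 𝒰} {dev N δ : 𝒰 → ℝ}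
    {A : 𝒰 → ι → 𝔸} {plaq : Set (ι × ι × ι × ι)} {ξ α₀ α₁' t κ B : ℝ}
    (hξ0 : 0 < ξ) (hξ1 : ξ ≤ 1) (hα₀ : α₀ ≤ 1 / 2) (hα₁ : 0 < α₁') (hκ : 0 ≤ κ)
    (hdev : ∀ u ∈ dom, 0 ≤ dev u) (hN0 : ∀ u ∈ dom, 0 ≤ N u) (hN : ∀ u ∈ dom, N u ≤ dev u)
    (hA : ∀ u ∈ dom, ∀ i, ‖A u i‖ ≤ N u) (hδ0 : ∀ u ∈ dom, 0 ≤ δ u) (hδ : ∀ u ∈ dom, δ u ≤ κ * dev u)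
    (hcurv : ∀ u ∈ dom, ∀ p ∈ plaq, ‖plaqHol (segScalar ξ 1) (A u) p - 1‖ ≤ δ u * ξ ^ 2)
    (hsum : ∀ u ∈ dom, δ u + κ * α₁' + 32 * (dev u + α₁') ^ 2 ≤ α₀) (ht : ∀ u ∈ dom, dev u + α₁' ≤ t)
    (hleaf : ∀ u ∈ dom, 0 < dev u → ∀ b ∈ S, ∃ g : ℂ → F, g 0 = m u₀ b ∧ g 1 = m u b ∧
      DifferentiableOn ℂ g (tubeParam ξ α₀ α₁' t plaq (A u) (N u)) ∧
      ∀ s ∈ tubeParam ξ α₀ α₁' t plaq (A u) (N u), ‖g s‖ ≤ B)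
    (hflat : ∀ u ∈ dom, dev u = 0 → ∀ b ∈ S, m u b = m u₀ b) :
    T4FirstOrderSize.MeanLipschitz dom m S u₀ dev (4 * B / α₁') := by
  refine T4AxialChain.meanLipschitz_of_segment hα₁ hdev (fun u hu hpos b hb => ?_) hflat
  obtain ⟨g, hg0, hg1, hg, hB⟩ := hleaf u hu hpos b hb
  exact ⟨g, _, hg0, hg1, hg, hB, fun s₀ hs₀ =>
    closedBall_subset_tubeParam hξ0 hξ1 hα₀ hα₁.le hκ hpos (hN0 u hu) (hN u hu) (hA u hu) (hδ0 u hu)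
      (hδ u hu) (hsum u hu) (ht u hu) (hcurv u hu) hs₀⟩

/-- … and with a vanishing mean at the flat reference, the CONDITIONAL-MEAN SUPPRESSION at birth
`‖m u b‖ ≤ (4B/α₁′)·dev u` (`T4FirstOrderSize.condMeanSuppression_of_flat`). [folklore] -/
theorem condMeanSuppression_birth {dom : Set 𝒰} {m : 𝒰 → β → F} {S : Finset β} {u₀ : 𝒰}
    {dev N δ : 𝒰 → ℝ} {A : 𝒰 → ι → 𝔸} {plaq : Set (ι × ι × ι × ι)} {ξ α₀ α₁' t κ B : ℝ}
    (hξ0 : 0 < ξ) (hξ1 : ξ ≤ 1) (hα₀ : α₀ ≤ 1 / 2) (hα₁ : 0 < α₁') (hκ : 0 ≤ κ)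
    (hdev : ∀ u ∈ dom, 0 ≤ dev u) (hN0 : ∀ u ∈ dom, 0 ≤ N u) (hN : ∀ u ∈ dom, N u ≤ dev u)
    (hA : ∀ u ∈ dom, ∀ i, ‖A u i‖ ≤ N u) (hδ0 : ∀ u ∈ dom, 0 ≤ δ u) (hδ : ∀ u ∈ dom, δ u ≤ κ * dev u)
    (hcurv : ∀ u ∈ dom, ∀ p ∈ plaq, ‖plaqHol (segScalar ξ 1) (A u) p - 1‖ ≤ δ u * ξ ^ 2)
    (hsum : ∀ u ∈ dom, δ u + κ * α₁' + 32 * (dev u + α₁') ^ 2 ≤ α₀) (ht : ∀ u ∈ dom, dev u + α₁' ≤ t)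
    (h0 : T4FirstOrderSize.MeanVanishes S (m u₀))
    (hleaf : ∀ u ∈ dom, 0 < dev u → ∀ b ∈ S, ∃ g : ℂ → F, g 0 = m u₀ b ∧ g 1 = m u b ∧
      DifferentiableOn ℂ g (tubeParam ξ α₀ α₁' t plaq (A u) (N u)) ∧
      ∀ s ∈ tubeParam ξ α₀ α₁' t plaq (A u) (N u), ‖g s‖ ≤ B)
    (hflat : ∀ u ∈ dom, dev u = 0 → ∀ b ∈ S, m u b = m u₀ b) :
    T4FirstOrderSize.CondMeanSuppression dom m S dev (4 * B / α₁') :=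
  T4FirstOrderSize.condMeanSuppression_of_flat h0
    (meanLipschitz_birth hξ0 hξ1 hα₀ hα₁ hκ hdev hN0 hN hA hδ0 hδ hcurv hsum ht hleaf hflat)

/-- UNIFORM CONSTANTS (the birth instantiation of the cell's record, `a` standing for `α_{0,j}`): exteriors with
curvature constants `δ u ≤ a` and potential deviations `dev u ≤ dev₀`, the booked fraction `μ` of the creation
enlargement with `κα₁′ + 32(dev₀ + α₁′)² ≤ μ·a` and `(1 + μ)·a ≤ 1/2`; the tube is taken at the TARGET constant
`α₀ = (1 + μ)·a` and `t = dev₀ + α₁′`.  Then `MeanLipschitz dom m S u₀ dev (4B/α₁′)`. [folklore] -/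
theorem meanLipschitz_birth_uniform {dom : Set 𝒰} {m : 𝒰 → β → F} {S : Finset β} {u₀ : 𝒰}
    {dev N δ : 𝒰 → ℝ} {A : 𝒰 → ι → 𝔸} {plaq : Set (ι × ι × ι × ι)} {ξ a μ α₁' dev₀ κ B : ℝ}
    (hξ0 : 0 < ξ) (hξ1 : ξ ≤ 1) (hα₁ : 0 < α₁') (hκ : 0 ≤ κ)
    (hq : κ * α₁' + 32 * (dev₀ + α₁') ^ 2 ≤ μ * a) (hhalf : (1 + μ) * a ≤ 1 / 2)
    (hdev : ∀ u ∈ dom, 0 ≤ dev u) (hdev₀ : ∀ u ∈ dom, dev u ≤ dev₀)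
    (hN0 : ∀ u ∈ dom, 0 ≤ N u) (hN : ∀ u ∈ dom, N u ≤ dev u) (hA : ∀ u ∈ dom, ∀ i, ‖A u i‖ ≤ N u)
    (hδ0 : ∀ u ∈ dom, 0 ≤ δ u) (hδ : ∀ u ∈ dom, δ u ≤ κ * dev u) (hδa : ∀ u ∈ dom, δ u ≤ a)
    (hcurv : ∀ u ∈ dom, ∀ p ∈ plaq, ‖plaqHol (segScalar ξ 1) (A u) p - 1‖ ≤ δ u * ξ ^ 2)
    (hleaf : ∀ u ∈ dom, 0 < dev u → ∀ b ∈ S, ∃ g : ℂ → F, g 0 = m u₀ b ∧ g 1 = m u b ∧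
      DifferentiableOn ℂ g (tubeParam ξ ((1 + μ) * a) α₁' (dev₀ + α₁') plaq (A u) (N u)) ∧
      ∀ s ∈ tubeParam ξ ((1 + μ) * a) α₁' (dev₀ + α₁') plaq (A u) (N u), ‖g s‖ ≤ B)
    (hflat : ∀ u ∈ dom, dev u = 0 → ∀ b ∈ S, m u b = m u₀ b) :
    T4FirstOrderSize.MeanLipschitz dom m S u₀ dev (4 * B / α₁') :=
  meanLipschitz_birth hξ0 hξ1 hhalf hα₁ hκ hdev hN0 hN hA hδ0 hδ hcurv
    (fun u hu => curvature_budget_birth (hδa u hu)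
      ((quadratic_member_mono hα₁.le (hdev u hu) (hdev₀ u hu)).trans hq))
    (fun u hu => by linarith [hdev₀ u hu]) hleaf hflat

/-- … and the conditional-mean suppression from uniform constants. [folklore] -/
theorem condMeanSuppression_birth_uniform {dom : Set 𝒰} {m : 𝒰 → β → F} {S : Finset β} {u₀ : 𝒰}
    {dev N δ : 𝒰 → ℝ} {A : 𝒰 → ι → 𝔸} {plaq : Set (ι × ι × ι × ι)} {ξ a μ α₁' dev₀ κ B : ℝ}
    (hξ0 : 0 < ξ) (hξ1 : ξ ≤ 1) (hα₁ : 0 < α₁') (hκ : 0 ≤ κ)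
    (hq : κ * α₁' + 32 * (dev₀ + α₁') ^ 2 ≤ μ * a) (hhalf : (1 + μ) * a ≤ 1 / 2)
    (hdev : ∀ u ∈ dom, 0 ≤ dev u) (hdev₀ : ∀ u ∈ dom, dev u ≤ dev₀)
    (hN0 : ∀ u ∈ dom, 0 ≤ N u) (hN : ∀ u ∈ dom, N u ≤ dev u) (hA : ∀ u ∈ dom, ∀ i, ‖A u i‖ ≤ N u)
    (hδ0 : ∀ u ∈ dom, 0 ≤ δ u) (hδ : ∀ u ∈ dom, δ u ≤ κ * dev u) (hδa : ∀ u ∈ dom, δ u ≤ a)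
    (hcurv : ∀ u ∈ dom, ∀ p ∈ plaq, ‖plaqHol (segScalar ξ 1) (A u) p - 1‖ ≤ δ u * ξ ^ 2)
    (h0 : T4FirstOrderSize.MeanVanishes S (m u₀))
    (hleaf : ∀ u ∈ dom, 0 < dev u → ∀ b ∈ S, ∃ g : ℂ → F, g 0 = m u₀ b ∧ g 1 = m u b ∧
      DifferentiableOn ℂ g (tubeParam ξ ((1 + μ) * a) α₁' (dev₀ + α₁') plaq (A u) (N u)) ∧
      ∀ s ∈ tubeParam ξ ((1 + μ) * a) α₁' (dev₀ + α₁') plaq (A u) (N u), ‖g s‖ ≤ B)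
    (hflat : ∀ u ∈ dom, dev u = 0 → ∀ b ∈ S, m u b = m u₀ b) :
    T4FirstOrderSize.CondMeanSuppression dom m S dev (4 * B / α₁') :=
  T4FirstOrderSize.condMeanSuppression_of_flat h0
    (meanLipschitz_birth_uniform hξ0 hξ1 hα₁ hκ hq hhalf hdev hdev₀ hN0 hN hA hδ0 hδ hδa hcurv hleaf hflat)

end Assembly

/-! ## §4  The configuration-level leaf (finite bond set): analyticity of the mean on a class of configurations
containing the segment [bookkeeping] -/

section ConfigLeaf

variable {ι : Type*} [Fintype ι] {𝔸 : Type*} [NormedRing 𝔸] [NormedAlgebra ℂ 𝔸] [CompleteSpace 𝔸]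
variable {𝒰 β F : Type*} [NormedAddCommGroup F] [NormedSpace ℂ F] [CompleteSpace F]

/-- The SEGMENT CONFIGURATION at parameter `s`: bond `i` carries `exp(iξs · A i)`. [folklore] -/
def segConfig (ξ : ℝ) (A : ι → 𝔸) (s : ℂ) : ι → 𝔸 := fun i => exp (segScalar ξ s • A i)

omit [Fintype ι] [CompleteSpace 𝔸] in
/-- The bond variable of the segment configuration, unfolded. [folklore] -/
theorem segConfig_apply (ξ : ℝ) (A : ι → 𝔸) (s : ℂ) (i : ι) : segConfig ξ A s i = exp (segScalar ξ s • A i) :=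
  rfl

omit [Fintype ι] [CompleteSpace 𝔸] in
/-- The plaquette variables of the segment configuration are the `plaqHol`'s of §2. [folklore] -/
theorem plaqHol_eq_segConfig (ξ : ℝ) (A : ι → 𝔸) (s : ℂ) (p : ι × ι × ι × ι) :
    plaqHol (segScalar ξ s) A p = segConfig ξ A s p.1 * segConfig ξ A s p.2.1 *
      exp (-(segScalar ξ s • A p.2.2.1)) * exp (-(segScalar ξ s • A p.2.2.2)) :=
  rfl

omit [Fintype ι] [CompleteSpace 𝔸] in
/-- At `s = 0` the segment configuration is the flat one. [folklore] -/
@[simp] theorem segConfig_zero (ξ : ℝ) (A : ι → 𝔸) : segConfig ξ A 0 = 1 := by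
  funext i
  simp [segConfig]

omit [Fintype ι] [CompleteSpace 𝔸] in
/-- A vanishing potential gives the flat configuration at every parameter. [folklore] -/
theorem segConfig_eq_one_of_eq_zero (ξ : ℝ) {A : ι → 𝔸} (hA : ∀ i, A i = 0) (s : ℂ) : segConfig ξ A s = 1 := by
  funext i
  simp [segConfig, hA i]

omit [Fintype ι] in
/-- The segment configuration is an ENTIRE function of the parameter (coordinatewise: each coordinate is
`c ↦ exp(c • A i)` after the linear map `s ↦ iξs`, Mathlib `hasDerivAt_exp_smul_const`). [folklore] -/
theorem differentiable_segConfig (ξ : ℝ) (A : ι → 𝔸) : Differentiable ℂ (segConfig ξ A) := by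
  refine differentiable_pi.mpr fun i => ?_
  have h1 : Differentiable ℂ (fun c : ℂ => exp (c • A i)) := fun c =>
    (hasDerivAt_exp_smul_const (A i) c).differentiableAt
  have h2 : Differentiable ℂ (fun s : ℂ => segScalar ξ s) := by
    unfold segScalar; fun_prop
  exact h1.comp h2

/-- THE CONFIGURATION-LEVEL LEAF ⇒ `MeanLipschitz` AT BIRTH.  Hypotheses beyond the chain data and the budget of
`meanLipschitz_birth`: a functional `Mc` on link configurations of the (finite) bond set, complex differentiable and
bounded by `B` (for the bonds `b ∈ S`) on a set `𝒞` of configurations which CONTAINS every segment configuration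
`segConfig ξ (A u) s` with `s` in the tube of `u` (the instantiating seat's reading of the printed small-field
clauses — a HYPOTHESIS), and the set-up (b1): `m u b = Mc (segConfig ξ (A u) 1) b` (the exterior `u ∈ dom` IS its
axial-gauge representative `exp(iξA_u)`) and `m u₀ b = Mc 1 b` (flat reference).  The flat case `dev u = 0` forces
`A u = 0` and needs no separate hypothesis. [folklore] -/
theorem meanLipschitz_birth_of_class {dom : Set 𝒰} {m : 𝒰 → β → F} {S : Finset β} {u₀ : 𝒰}
    {dev N δ : 𝒰 → ℝ} {A : 𝒰 → ι → 𝔸} {plaq : Set (ι × ι × ι × ι)} {ξ α₀ α₁' t κ B : ℝ}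
    {𝒞 : Set (ι → 𝔸)} {Mc : (ι → 𝔸) → β → F}
    (hξ0 : 0 < ξ) (hξ1 : ξ ≤ 1) (hα₀ : α₀ ≤ 1 / 2) (hα₁ : 0 < α₁') (hκ : 0 ≤ κ)
    (hdev : ∀ u ∈ dom, 0 ≤ dev u) (hN0 : ∀ u ∈ dom, 0 ≤ N u) (hN : ∀ u ∈ dom, N u ≤ dev u)
    (hA : ∀ u ∈ dom, ∀ i, ‖A u i‖ ≤ N u) (hδ0 : ∀ u ∈ dom, 0 ≤ δ u) (hδ : ∀ u ∈ dom, δ u ≤ κ * dev u)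
    (hcurv : ∀ u ∈ dom, ∀ p ∈ plaq, ‖plaqHol (segScalar ξ 1) (A u) p - 1‖ ≤ δ u * ξ ^ 2)
    (hsum : ∀ u ∈ dom, δ u + κ * α₁' + 32 * (dev u + α₁') ^ 2 ≤ α₀) (ht : ∀ u ∈ dom, dev u + α₁' ≤ t)
    (hMdiff : ∀ b ∈ S, DifferentiableOn ℂ (fun W => Mc W b) 𝒞)
    (hMB : ∀ W ∈ 𝒞, ∀ b ∈ S, ‖Mc W b‖ ≤ B)
    (hclass : ∀ u ∈ dom, ∀ s ∈ tubeParam ξ α₀ α₁' t plaq (A u) (N u), segConfig ξ (A u) s ∈ 𝒞)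
    (hm : ∀ u ∈ dom, ∀ b ∈ S, m u b = Mc (segConfig ξ (A u) 1) b) (hm₀ : ∀ b ∈ S, m u₀ b = Mc 1 b) :
    T4FirstOrderSize.MeanLipschitz dom m S u₀ dev (4 * B / α₁') := by
  refine meanLipschitz_birth hξ0 hξ1 hα₀ hα₁ hκ hdev hN0 hN hA hδ0 hδ hcurv hsum ht ?_ ?_
  · intro u hu _ b hb
    refine ⟨fun s => Mc (segConfig ξ (A u) s) b, ?_, ?_, ?_, ?_⟩
    · simp only [segConfig_zero]; exact (hm₀ b hb).symm
    · exact (hm u hu b hb).symm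
    · exact (hMdiff b hb).comp (differentiable_segConfig ξ (A u)).differentiableOn
        (fun s hs => hclass u hu s hs)
    · exact fun s hs => hMB _ (hclass u hu s hs) b hb
  · intro u hu h0 b hb
    have hN0' : N u = 0 := le_antisymm (h0 ▸ hN u hu) (hN0 u hu)
    have hA0 : ∀ i, A u i = 0 := fun i => norm_le_zero_iff.mp (hN0' ▸ hA u hu i)
    rw [hm u hu b hb, segConfig_eq_one_of_eq_zero ξ hA0, hm₀ b hb]

/-- … and the conditional-mean suppression at birth from the configuration-level leaf. [folklore] -/
theorem condMeanSuppression_birth_of_class {dom : Set 𝒰} {m : 𝒰 → β → F} {S : Finset β} {u₀ : 𝒰}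
    {dev N δ : 𝒰 → ℝ} {A : 𝒰 → ι → 𝔸} {plaq : Set (ι × ι × ι × ι)} {ξ α₀ α₁' t κ B : ℝ}
    {𝒞 : Set (ι → 𝔸)} {Mc : (ι → 𝔸) → β → F}
    (hξ0 : 0 < ξ) (hξ1 : ξ ≤ 1) (hα₀ : α₀ ≤ 1 / 2) (hα₁ : 0 < α₁') (hκ : 0 ≤ κ)
    (hdev : ∀ u ∈ dom, 0 ≤ dev u) (hN0 : ∀ u ∈ dom, 0 ≤ N u) (hN : ∀ u ∈ dom, N u ≤ dev u)
    (hA : ∀ u ∈ dom, ∀ i, ‖A u i‖ ≤ N u) (hδ0 : ∀ u ∈ dom, 0 ≤ δ u) (hδ : ∀ u ∈ dom, δ u ≤ κ * dev u)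
    (hcurv : ∀ u ∈ dom, ∀ p ∈ plaq, ‖plaqHol (segScalar ξ 1) (A u) p - 1‖ ≤ δ u * ξ ^ 2)
    (hsum : ∀ u ∈ dom, δ u + κ * α₁' + 32 * (dev u + α₁') ^ 2 ≤ α₀) (ht : ∀ u ∈ dom, dev u + α₁' ≤ t)
    (h0 : T4FirstOrderSize.MeanVanishes S (m u₀))
    (hMdiff : ∀ b ∈ S, DifferentiableOn ℂ (fun W => Mc W b) 𝒞)
    (hMB : ∀ W ∈ 𝒞, ∀ b ∈ S, ‖Mc W b‖ ≤ B)
    (hclass : ∀ u ∈ dom, ∀ s ∈ tubeParam ξ α₀ α₁' t plaq (A u) (N u), segConfig ξ (A u) s ∈ 𝒞)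
    (hm : ∀ u ∈ dom, ∀ b ∈ S, m u b = Mc (segConfig ξ (A u) 1) b) (hm₀ : ∀ b ∈ S, m u₀ b = Mc 1 b) :
    T4FirstOrderSize.CondMeanSuppression dom m S dev (4 * B / α₁') :=
  T4FirstOrderSize.condMeanSuppression_of_flat h0
    (meanLipschitz_birth_of_class hξ0 hξ1 hα₀ hα₁ hκ hdev hN0 hN hA hδ0 hδ hcurv hsum ht hMdiff hMB hclass hm hm₀)

end ConfigLeaf

end Literature.MathematicalPhysics.QuantumFieldTheory.Balaban1983to89.T4MeanLipschitzBirth
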